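import Summits.AtomisticToContinuum.Crystallization.Theorems.ChargedEnergyGapDominoLedgerK
import HarnessLib

/-!
# CapFloor (lens-3 g90, NODE 101) — the deep-hole floor of the domino cap as a census cap row

`domCapK unit ϱ τ ρ d = κ(d)·unit/10 + max (κ(d)·103/100·(τ·2ρ)²·roofVal T75 (tiltSext ϱ ρ d)) (if 241/2 ≤ d then 45·unit else 0)` (tree `…DominoLedgerK`).
The roof term vanishes for charge depths `t ≳ 124.3` (the tilted two-foot sextuple enters the zero region of `T75`) and is below `45·unit` from
`t ≈ 120.5` on, so for cells with `lo ≥ 241/2` the census cap row is the FLOOR: `(451/10)·unit ≤ domCapK unit ϱ τ ρ t` — one line per cell, no prices.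
* `one_le_domKappa`, `domKappa_le_two`; ★ `domCapK_ge_floor (hu : 0 ≤ unit) (hd : 241/2 ≤ d) : 451/10 * unit ≤ domCapK unit ϱ τ ρ d`;
* `domCapK_ge_tenth (hu) (hroof : 0 ≤ roofVal T75 (tiltSext ϱ ρ d)) : unit/10 ≤ domCapK …` is NOT provided here (needs roof non-negativity from `…RoofDuality`;
  the zero-price row of NODE 100 `isRoofDualFeasible_T75_zero` with NODE 99 gives `κ(hi)·unit/10` directly);
* `capFloor_cell (hu : 0 ≤ unit) {lo : ℝ} (hlo : 241/2 ≤ lo) : ∀ ρ t, lo ≤ t → 451/10 * unit ≤ domCapK unit ϱ τ ρ t` (the census line).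
-/

noncomputable section
open scoped Classical
open Literature.MathematicalPhysics.StatisticalMechanics Literature.Geometry.DiscreteGeometry
open Summit.AtomisticToContinuum.Crystallization.Theses.PricedLinkCensus
open Summit.AtomisticToContinuum.Crystallization.Theorems.ChargedEnergyGapNegative

namespace Summit.AtomisticToContinuum.Crystallization.Theorems.ChargedEnergyGapChartDial

/-- `1 ≤ domKappa d` for every `d` (`le_max_left`). [formal bookkeeping; lane docstring, hand-2 g43] -/
theorem one_le_domKappa (d : ℝ) : 1 ≤ domKappa d := le_max_left _ _

/-- `domKappa d ≤ 2` for every `d`. [formal bookkeeping; lane docstring, hand-2 g43] -/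
theorem domKappa_le_two (d : ℝ) : domKappa d ≤ 2 := by
  unfold domKappa
  exact max_le (by norm_num) (min_le_left _ _)

/-- ★ The deep-hole floor: for `d ≥ 241/2`, `Ĉ(d) ≥ κ(d)·unit/10 + 45·unit ≥ (451/10)·unit`. -/
theorem domCapK_ge_floor {unit : ℝ} (hu : 0 ≤ unit) (ϱ τ ρ : ℝ) {d : ℝ} (hd : (241 / 2 : ℝ) ≤ d) :
    451 / 10 * unit ≤ domCapK unit ϱ τ ρ d := by
  unfold domCapK
  rw [if_pos hd]
  have hκ : 1 ≤ domKappa d := one_le_domKappa d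
  have h45 : 45 * unit ≤ max (domKappa d * (103 / 100 * ((τ * (2 * ρ)) ^ 2 * roofVal T75 (tiltSext ϱ ρ d)))) (45 * unit) :=
    le_max_right _ _
  nlinarith

/-- The census line for a cell with `lo ≥ 241/2`: cap `≥ 45.1·unit` uniformly in `ρ` and `t ∈ [lo, ∞)`. -/
theorem capFloor_cell {unit : ℝ} (hu : 0 ≤ unit) (ϱ τ : ℝ) {lo : ℝ} (hlo : (241 / 2 : ℝ) ≤ lo) :
    ∀ ρ t : ℝ, lo ≤ t → 451 / 10 * unit ≤ domCapK unit ϱ τ ρ t :=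
  fun ρ _ ht => domCapK_ge_floor hu ϱ τ ρ (le_trans hlo ht)

end Summit.AtomisticToContinuum.Crystallization.Theorems.ChargedEnergyGapChartDial

end
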